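import Summits.CriticalPhenomena.PercolationContinuityZ3.Theorems.PercNearOneGluingNoHeavyLowerTailSahiCombSaturation
import Summits.CriticalPhenomena.PercolationContinuityZ3.Theorems.PercNearOneGluingNoHeavyLowerTailSahiC3CombCubeFive
import Summits.CriticalPhenomena.PercolationContinuityZ3.Theorems.PercNearOneGluingNoHeavyLowerTailSahiC4CubeFive
import Summits.CriticalPhenomena.PercolationContinuityZ3.Theorems.PercNearOneGluingNoHeavyLowerTailSahiC4CubeColourFour
import Summits.CriticalPhenomena.PercolationContinuityZ3.Theorems.PercNearOneGluingNoHeavyLowerTailSahiC4CombBridge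

/-!
# (M⁺-4) ON FIVE LETTERS: Sahi's `C₄` holds COEFFICIENTWISE (in the quartic tensor-Bernstein basis) on every ground set of size `≤ 5`
# — typer gen 28's coloured-antichain certificate `colourCheck4_five` read at comb level through the every-order comb saturation

Support file (cell `prim-sahi`, seat `prim-sahi-typer` gen 33; `--supports stmt-CriticalPhenomena-4575`; proposed `--computational`: the closure
of `combPos_sahiE_four_of_card_le_five` is the standard axioms plus EXACTLY eighteen `native_decide` axioms, all but one pre-existing — the eight
`colourCheck4_five` chunks `SahiC4Cube.colour4Chunk_five_a1/a2/a2s/b1/b2/b2s/c/d` (typer gen 28), the eight `colourCheck_five` chunks and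
`checkCube_four` behind (M⁺-3) on `≤ 5` letters (…`SahiC3CombCubeFive`), and `colourCheck4_four` (…`SahiC4CubeColourFour`, this generation);
the size-`≤ 3` cubes use P3's kernel `decide`s `checkCube4_zero…three`; no evaluation here, no `sorry`).

THE MATHEMATICS.  (M⁺-4) (`MasterFamilyCombPos 4` / `SahiC4Cube.SahiE4CombPositivity`, equivalent by P3's `…SahiC4CombBridge`): for increasing
`A, B, C, D ⊆ 2^ι`, `p ↦ E₄(μ_p; 1_A, 1_B, 1_C, 1_D)` is a nonnegative combination of `∏_e p_e^{j_e}(1−p_e)^{4−j_e}`; kernel on cubes of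
dimension `≤ 3` (`sahiE4CombPositivityUpTo_three`), open from dimension `4` on at comb level (the value-level `sahiC4_cube_four/five` are
theorems).  Typer gen 28's `colourCheck4 m σ` runs the order-4 DIGIT TEST `checkQuad` — which certifies EVERY quartic tensor-Bernstein coefficient
(`e4Coef_nonneg_of_checkQuad`, P3; `SahiC4CombBridge.combPos_of_e4Coef_nonneg`) — on the quadruples co-generated by 4-coloured antichains, passing
a leaf outright when a colour class is empty (the member is the whole cube and `E₄(1, f, g, h) = 2·E₃(f, g, h)`, Sahi's branching identity
`sahiE_one_cons`).  So a passing check is a COMB certificate on the coloured quadruples, given (M⁺-3) on the same cube for the degenerate leaves;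
and the every-order comb saturation `SahiComb.combPos_sahiE_of_colouring` (…`SahiCombSaturation`, this generation; its lower-order input is
(M⁺-1), (M⁺-2) — theorems everywhere — and (M⁺-3) on the cube) extends it to ALL quadruples:

* `combPos_sahiE_four_of_head_one` — `E₄(1, g) = 2E₃(g)` at comb level;
* `combPos_coMember4_of_leafT4`, `combPos_colourMember4_of_colourCheck4` — the leaves / the check read as comb certificates;
* **`combPos_sahiE_four_of_colourCheck4`** — `colourCheck4 m σ = true` + (M⁺-3) on `Fin m` ⟹ (M⁺-4) on `Fin m`;
* **`combPos_sahiE_four_cube_four`**, **`combPos_sahiE_four_cube_five`** — (M⁺-4) on `{0,1}^4` and `{0,1}^5`;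
* **`combPos_sahiE_four_of_card_le_five`** — **(M⁺-4) ON EVERY GROUND SET WITH `≤ 5` ELEMENTS**: Sahi's `C₄` for all product measures on
  five letters holds coefficientwise; hence at every `p` (`sahiE_four_ind_nonneg_of_card_le_five`, recovering `sahiC4_cube_five`) and with
  density-free zero sets (`sahiE_four_ind_eq_zero_of_interior_zero_of_card_le_five`); `sahiE4CombPositivityUpTo_five` (P3's typing, cubes `Fin m`,
  `m ≤ 5`).
HONEST LABEL: computational (closure listed above); (M⁺-4) on six or more letters, Sahi's `C₄` and `C₃` in general remain OPEN; nothing here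
asserts them. [this work]
-/

namespace Summit.CriticalPhenomena.PercolationContinuityZ3.Theorems

open Finset Function Equiv
open Literature.Combinatorics.Sahi2008
open Literature.Probability.Percolation.DecisionTree (ind ind_of_mem ind_of_not_mem ind_nonneg)
open SahiComb

namespace SahiC4Cube

open OneCutCert CovTransferCert FourCopyCert SahiC3Cube
open scoped Classical

/-- **A trivial head at comb level**: if `p ↦ E₃(μ_p; g)` is comb-positive of multidegree `3` then `p ↦ E₄(μ_p; 1, g) = 2·E₃(μ_p; g)` (Sahi's
branching identity `sahiE_one_cons`) is comb-positive of multidegree `4`. [this work] -/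
theorem combPos_sahiE_four_of_head_one {ι : Type} [Fintype ι] (g : Fin 3 → Set ι → ℝ)
    (h3 : CombPos (fun _ : ι => 3) (fun p => sahiE (bernoulliWeight p) 3 g)) :
    CombPos (fun _ : ι => 4) (fun p => sahiE (bernoulliWeight p) 4 (Matrix.vecCons 1 g)) := by
  have hle : (fun _ : ι => 3) ≤ (fun _ : ι => 4) := fun _ => by norm_num
  refine ((h3.smul (by norm_num : (0 : ℝ) ≤ 2)).mono hle).congr fun p => ?_
  have h := sahiE_one_cons (sum_bernoulliWeight p) 2 g
  push_cast at h
  exact h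

/-- **A passing leaf is a comb certificate of the co-generated quadruple**, given (M⁺-3) on the cube `Fin m` for the leaves with an empty colour
class (member `= univ`, `E₄ = 2E₃`); the other leaves pass the digit test, which certifies every quartic tensor-Bernstein coefficient
(`e4Coef_nonneg_of_checkQuad`, `SahiC4CombBridge.combPos_of_e4Coef_nonneg`). [this work] -/
theorem combPos_coMember4_of_leafT4 {m σ : ℕ} (hσ : 0 < σ) (hbnd : 24 * 16 ^ m < 2 ^ (σ - 1))
    (hC3 : ∀ {A B C : Set (Set (Fin m))}, IsUpperSet A → IsUpperSet B → IsUpperSet C →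
      CombPos (fun _ : Fin m => 3) (fun p => sahiE (bernoulliWeight p) 3 ![ind A, ind B, ind C]))
    (N : Finset (Set (Fin m))) (c : Set (Fin m) → Fin 4)
    (hleaf : leafT4 σ m (krT5 σ m (fullN m)) (offM σ m) (offM σ m).toNat (downMask4 m (N.image encS) (fun x => c (SahiC3Cube.pt m x)) 0)
      (downMask4 m (N.image encS) (fun x => c (SahiC3Cube.pt m x)) 1) (downMask4 m (N.image encS) (fun x => c (SahiC3Cube.pt m x)) 2)
      (downMask4 m (N.image encS) (fun x => c (SahiC3Cube.pt m x)) 3) = true) :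
    CombPos (fun _ : Fin m => 4) (fun p => sahiE (bernoulliWeight p) 4
      ![ind {S | ∀ T ∈ N, c T = 0 → ¬ S ⊆ T}, ind {S | ∀ T ∈ N, c T = 1 → ¬ S ⊆ T},
        ind {S | ∀ T ∈ N, c T = 2 → ¬ S ⊆ T}, ind {S | ∀ T ∈ N, c T = 3 → ¬ S ⊆ T}]) := by
  have hU : ∀ i : Fin 4, IsUpperSet {S : Set (Fin m) | ∀ T ∈ N, c T = i → ¬ S ⊆ T} := isUpperSet_coMember4 N c
  have h1 : ind (Set.univ : Set (Set (Fin m))) = 1 := funext fun ω => ind_of_mem (Set.mem_univ ω)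
  unfold leafT4 at hleaf
  rw [Bool.or_eq_true, decide_eq_true_eq] at hleaf
  rcases hleaf with hzero | hdig
  · -- an empty colour class: that member is `univ`; move it to the head (`sahiE_comp_perm`) and use `E₄(1, g) = 2E₃(g)`
    set U0 := {S : Set (Fin m) | ∀ T ∈ N, c T = 0 → ¬ S ⊆ T} with hU0
    set U1 := {S : Set (Fin m) | ∀ T ∈ N, c T = 1 → ¬ S ⊆ T} with hU1
    set U2 := {S : Set (Fin m) | ∀ T ∈ N, c T = 2 → ¬ S ⊆ T} with hU2
    set U3 := {S : Set (Fin m) | ∀ T ∈ N, c T = 3 → ¬ S ⊆ T} with hU3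
    rcases hzero with h | h | h | h
    · have hu : U0 = Set.univ := coMember4_eq_univ_of_downMask4_eq_zero N c 0 h
      rw [hu, h1]
      exact combPos_sahiE_four_of_head_one ![ind U1, ind U2, ind U3] (hC3 (hU 1) (hU 2) (hU 3))
    · have hu : U1 = Set.univ := coMember4_eq_univ_of_downMask4_eq_zero N c 1 h
      rw [hu, h1]
      refine (combPos_sahiE_four_of_head_one ![ind U0, ind U2, ind U3] (hC3 (hU 0) (hU 2) (hU 3))).congr fun p => ?_
      rw [← sahiE_comp_perm (bernoulliWeight p) 4 (swap 0 1) ![ind U0, 1, ind U2, ind U3]]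
      congr 1; funext j; fin_cases j <;> rfl
    · have hu : U2 = Set.univ := coMember4_eq_univ_of_downMask4_eq_zero N c 2 h
      rw [hu, h1]
      refine (combPos_sahiE_four_of_head_one ![ind U1, ind U0, ind U3] (hC3 (hU 1) (hU 0) (hU 3))).congr fun p => ?_
      rw [← sahiE_comp_perm (bernoulliWeight p) 4 (swap 0 2) ![ind U0, ind U1, 1, ind U3]]
      congr 1; funext j; fin_cases j <;> rfl
    · have hu : U3 = Set.univ := coMember4_eq_univ_of_downMask4_eq_zero N c 3 h
      rw [hu, h1]
      refine (combPos_sahiE_four_of_head_one ![ind U1, ind U2, ind U0] (hC3 (hU 1) (hU 2) (hU 0))).congr fun p => ?_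
      rw [← sahiE_comp_perm (bernoulliWeight p) 4 (swap 0 3) ![ind U0, ind U1, ind U2, 1]]
      congr 1; funext j; fin_cases j <;> rfl
  · -- the digit test certifies every quartic tensor-Bernstein coefficient
    rw [checkQuadH_eq, ← encA_colourMember4 N c 0, ← encA_colourMember4 N c 1, ← encA_colourMember4 N c 2,
      ← encA_colourMember4 N c 3] at hdig
    refine SahiC4CombBridge.combPos_of_e4Coef_nonneg (e4Coef_nonneg_of_checkQuad (σ := σ) ?_)
    unfold checkQuad
    simp only [Bool.and_eq_true, decide_eq_true_eq]
    exact ⟨⟨hσ, hbnd⟩, hdig⟩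

/-- **`colourCheck4` read at comb level**: if `colourCheck4 m σ = true` and (M⁺-3) holds on the cube `Fin m`, then for every antichain `N ⊆ 2^[m]`
and every colouring `c : 2^[m] → Fin 4` the co-generated quadruple has comb-positive `E₄` (relabel the colours by the `π` of
`leafT4_of_colourCheck4`; `E₄` is symmetric, `sahiE_comp_perm`). [this work] -/
theorem combPos_colourMember4_of_colourCheck4 {m σ : ℕ} (h : colourCheck4 m σ = true)
    (hC3 : ∀ {A B C : Set (Set (Fin m))}, IsUpperSet A → IsUpperSet B → IsUpperSet C →
      CombPos (fun _ : Fin m => 3) (fun p => sahiE (bernoulliWeight p) 3 ![ind A, ind B, ind C]))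
    (N : Finset (Set (Fin m))) (c : Set (Fin m) → Fin 4) (hN : IsAntichain (· ≤ ·) (N : Set (Set (Fin m)))) :
    CombPos (fun _ : Fin m => 4) (fun p => sahiE (bernoulliWeight p) 4 (fun i => ind {S | ∀ T ∈ N, c T = i → ¬ S ⊆ T})) := by
  have h' := h
  unfold colourCheck4 at h'
  simp only [Bool.and_eq_true, decide_eq_true_eq] at h'
  obtain ⟨⟨hσ, hbnd⟩, -⟩ := h'
  have hE : ∀ x ∈ N.image encS, x < 2 ^ m := by
    intro x hx
    obtain ⟨T, -, rfl⟩ := mem_image.1 hx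
    exact encS_lt T
  have hanti : ∀ x ∈ N.image encS, ∀ y ∈ N.image encS, x ≠ y → x &&& y ≠ x := by
    intro x hx y hy hxy hland
    obtain ⟨T, hT, rfl⟩ := mem_image.1 hx
    obtain ⟨T', hT', rfl⟩ := mem_image.1 hy
    have hsub : T ⊆ T' := by
      have := (land_eq_self_iff_pt_subset (encS T') (encS_lt T)).1 hland
      rwa [pt_encS, pt_encS] at this
    have hne : T ≠ T' := fun h => hxy (by rw [h])
    exact hN (mem_coe.2 hT) (mem_coe.2 hT') hne hsub
  obtain ⟨π, hleaf⟩ := leafT4_of_colourCheck4 h (N.image encS) (fun x => c (SahiC3Cube.pt m x)) hE hanti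
  have hcomb := combPos_coMember4_of_leafT4 hσ hbnd hC3 N (fun T => π (c T)) hleaf
  -- the family of `c` is the family of `π ∘ c` read through `π`
  set G : Fin 4 → Set (Fin m) → ℝ := fun k => ind {S : Set (Fin m) | ∀ T ∈ N, π (c T) = k → ¬ S ⊆ T} with hG
  have hFG : (fun i => ind {S : Set (Fin m) | ∀ T ∈ N, c T = i → ¬ S ⊆ T}) = fun i => G (π i) := by
    funext i
    simp only [hG]
    congr 1
    ext S
    simp only [Set.mem_setOf_eq]
    constructor
    · intro hq T hT hcT; exact hq T hT (π.injective hcT)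
    · intro hq T hT hcT; exact hq T hT (by rw [hcT])
  have hGvec : G = ![ind {S : Set (Fin m) | ∀ T ∈ N, π (c T) = 0 → ¬ S ⊆ T}, ind {S | ∀ T ∈ N, π (c T) = 1 → ¬ S ⊆ T},
      ind {S | ∀ T ∈ N, π (c T) = 2 → ¬ S ⊆ T}, ind {S | ∀ T ∈ N, π (c T) = 3 → ¬ S ⊆ T}] := by
    funext i; fin_cases i <;> rfl
  rw [hFG]
  refine hcomb.congr fun p => ?_
  rw [sahiE_comp_perm (bernoulliWeight p) 4 π G, hGvec]

/-- **`colourCheck4 m σ = true` + (M⁺-3) on `Fin m` ⟹ (M⁺-4) on `Fin m`**: comb positivity of `p ↦ E₄(μ_p; 1_U)` for EVERY quadruple of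
increasing families of `2^[m]` (the every-order comb saturation `SahiComb.combPos_sahiE_of_colouring` with (M⁺-1), (M⁺-2) from
`masterFamilyCombPos_one/two`). [this work] -/
theorem combPos_sahiE_four_of_colourCheck4 {m σ : ℕ} (h : colourCheck4 m σ = true)
    (hC3 : ∀ (V : Fin 3 → Set (Set (Fin m))), (∀ j, IsUpperSet (V j)) →
      CombPos (fun _ : Fin m => 3) (fun p => sahiE (bernoulliWeight p) 3 (fun j => ind (V j))))
    (U : Fin 4 → Set (Set (Fin m))) (hU : ∀ j, IsUpperSet (U j)) :
    CombPos (fun _ : Fin m => 4) (fun p => sahiE (bernoulliWeight p) 4 (fun j => ind (U j))) := by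
  have hC3' : ∀ {A B C : Set (Set (Fin m))}, IsUpperSet A → IsUpperSet B → IsUpperSet C →
      CombPos (fun _ : Fin m => 3) (fun p => sahiE (bernoulliWeight p) 3 ![ind A, ind B, ind C]) := by
    intro A B C hA hB hC
    exact (ThreePartition.combPos_vec_iff ![A, B, C]).1 (hC3 ![A, B, C] fun j => by fin_cases j <;> assumption)
  refine SahiComb.combPos_sahiE_of_colouring (n := 2) (fun k hk1 hk3 V hV => ?_)
    (fun N c hN => combPos_colourMember4_of_colourCheck4 h hC3' N c hN) U hU
  interval_cases k
  · exact masterFamilyCombPos_one (Fin m) V hV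
  · exact masterFamilyCombPos_two (Fin m) V hV
  · exact hC3 V hV

/-- **(M⁺-4) on the four-cube**: every quadruple of increasing families of `2^[4]` has comb-positive `E₄` (`colourCheck4_four` +
(M⁺-3) on `Fin 4` from `checkCube_four`). [this work] [computational] -/
theorem combPos_sahiE_four_cube_four (U : Fin 4 → Set (Set (Fin 4))) (hU : ∀ j, IsUpperSet (U j)) :
    CombPos (fun _ : Fin 4 => 4) (fun p => sahiE (bernoulliWeight p) 4 (fun j => ind (U j))) :=
  combPos_sahiE_four_of_colourCheck4 colourCheck4_four
    (fun V hV => SahiC3CombCube.combPos_sahiE_three_family_of_card_le_four (by simp) V hV) U hU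

/-- **(M⁺-4) on the five-cube**: every quadruple of increasing families of `2^[5]` has comb-positive `E₄` (`colourCheck4_five`, typer gen 28,
+ (M⁺-3) on five letters, …`SahiC3CombCubeFive`). [this work] [computational] -/
theorem combPos_sahiE_four_cube_five (U : Fin 4 → Set (Set (Fin 5))) (hU : ∀ j, IsUpperSet (U j)) :
    CombPos (fun _ : Fin 5 => 4) (fun p => sahiE (bernoulliWeight p) 4 (fun j => ind (U j))) :=
  combPos_sahiE_four_of_colourCheck4 colourCheck4_five
    (fun V hV => SahiC3CombCube.combPos_sahiE_three_family_of_card_le_five (by simp) V hV) U hU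

/-- Relabelling transport: (M⁺-k) for a family on `ι` from (M⁺-k) for its push-forward along `e : ι ≃ κ` (P3's `CombPos.comp_equiv` and
`sahiE_bernoulliWeight_comap_equiv`). [this work] -/
theorem combPos_sahiE_family_of_equiv {ι κ : Type} [Fintype ι] [Fintype κ] {k : ℕ} (e : ι ≃ κ) (U : Fin k → Set (Set ι))
    (h : CombPos (fun _ : κ => k) (fun p' => sahiE (bernoulliWeight p') k (fun j => ind (ThreePartition.comapFam e.symm (U j))))) :
    CombPos (fun _ : ι => k) (fun p => sahiE (bernoulliWeight p) k (fun j => ind (U j))) := by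
  have ht := SahiC4CombBridge.CombPos.comp_equiv e h
  exact ht.congr fun p => (SahiC4CombBridge.sahiE_bernoulliWeight_comap_equiv e p k U).symm

/-- **(M⁺-4) ON EVERY GROUND SET WITH AT MOST FIVE ELEMENTS — SAHI'S `C₄` HOLDS COEFFICIENTWISE ON FIVE LETTERS.**  For every finite `ι`
with `|ι| ≤ 5` and all increasing `U_0, U_1, U_2, U_3 ⊆ 2^ι`, `p ↦ E₄(μ_p; 1_{U_0}, 1_{U_1}, 1_{U_2}, 1_{U_3})` is a nonnegative combination of
the quartic tensor-Bernstein basis `∏_e p_e^{j_e}(1−p_e)^{4−j_e}` on `[0,1]^ι` (size `≤ 3`: P3's kernel `sahiE4CombPositivityUpTo_three`; sizes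
`4, 5`: the coloured-antichain certificates read at comb level). [this work] [computational] -/
theorem combPos_sahiE_four_of_card_le_five {ι : Type} [Fintype ι] (hι : Fintype.card ι ≤ 5) (U : Fin 4 → Set (Set ι))
    (hU : ∀ j, IsUpperSet (U j)) : CombPos (fun _ : ι => 4) (fun p => sahiE (bernoulliWeight p) 4 (fun j => ind (U j))) := by
  rcases Nat.lt_or_ge (Fintype.card ι) 4 with h3 | h4
  · -- `|ι| ≤ 3`: P3's kernel certificate on the cube `Fin (card ι)`
    refine combPos_sahiE_family_of_equiv (Fintype.equivFin ι) U ?_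
    have hU' : ∀ j, IsUpperSet (ThreePartition.comapFam (Fintype.equivFin ι).symm (U j)) :=
      fun j => SahiC4CombBridge.isUpperSet_comapFam (Fintype.equivFin ι) (hU j)
    rw [SahiC4CombBridge.ind_vec4 (fun j => ThreePartition.comapFam (Fintype.equivFin ι).symm (U j))]
    exact SahiC4CombBridge.combPos_of_e4Coef_nonneg
      (sahiE4CombPositivityUpTo_three _ (by omega) _ _ _ _ (hU' 0) (hU' 1) (hU' 2) (hU' 3))
  · rcases Nat.lt_or_ge (Fintype.card ι) 5 with h4' | h5
    · have hc : Fintype.card ι = 4 := by omega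
      let e : ι ≃ Fin 4 := Fintype.equivFinOfCardEq hc
      exact combPos_sahiE_family_of_equiv e U
        (combPos_sahiE_four_cube_four _ fun j => SahiC4CombBridge.isUpperSet_comapFam e (hU j))
    · have hc : Fintype.card ι = 5 := le_antisymm hι h5
      let e : ι ≃ Fin 5 := Fintype.equivFinOfCardEq hc
      exact combPos_sahiE_family_of_equiv e U
        (combPos_sahiE_four_cube_five _ fun j => SahiC4CombBridge.isUpperSet_comapFam e (hU j))

/-- Value level recovered: Sahi's `C₄` for every product measure on at most five letters (`ι = Fin 5`: typer gen 28's `sahiC4_cube_five`, now through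
the comb certificate). [this work] [computational] -/
theorem sahiE_four_ind_nonneg_of_card_le_five {ι : Type} [Fintype ι] (hι : Fintype.card ι ≤ 5) (U : Fin 4 → Set (Set ι))
    (hU : ∀ j, IsUpperSet (U j)) (p : ι → unitInterval) : 0 ≤ sahiE (bernoulliWeight p) 4 (fun j => ind (U j)) :=
  (combPos_sahiE_four_of_card_le_five hι U hU).nonneg p

/-- **Density-free zero set of `E₄` on five letters** ((M⁺-4) ⇒ (EQ⁰-4)): a zero of `p ↦ E₄(μ_p; 1_U)` in the OPEN cube `(0,1)^ι`, `|ι| ≤ 5`,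
forces `E₄(μ_p; 1_U) = 0` on all of `[0,1]^ι`. [this work] [computational] -/
theorem sahiE_four_ind_eq_zero_of_interior_zero_of_card_le_five {ι : Type} [Fintype ι] (hι : Fintype.card ι ≤ 5)
    {U : Fin 4 → Set (Set ι)} (hU : ∀ j, IsUpperSet (U j)) {q : ι → unitInterval}
    (hq : ∀ e, (q e : ℝ) ∈ Set.Ioo (0 : ℝ) 1) (h0 : sahiE (bernoulliWeight q) 4 (fun j => ind (U j)) = 0)
    (p : ι → unitInterval) : sahiE (bernoulliWeight p) 4 (fun j => ind (U j)) = 0 :=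
  (combPos_sahiE_four_of_card_le_five hι U hU).eq_zero_of_interior hq h0 p

/-- P3's typing: **`SahiE4CombPositivityUpTo 5`** — every quartic coefficient `e4Coef` of every increasing quadruple of the cubes `Fin m`, `m ≤ 5`,
is `≥ 0` (uniqueness of tensor-Bernstein coefficients, `SahiC4CombBridge.e4Coef_nonneg_of_combPos`). [this work] [computational] -/
theorem sahiE4CombPositivityUpTo_five : SahiE4CombPositivityUpTo 5 := by
  intro m hm A B C D hA hB hC hD
  have hcomb := combPos_sahiE_four_of_card_le_five (ι := Fin m) (by simpa using hm) ![A, B, C, D]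
    fun j => by fin_cases j <;> assumption
  rw [SahiC4CombBridge.ind_vec4 ![A, B, C, D]] at hcomb
  exact SahiC4CombBridge.e4Coef_nonneg_of_combPos hcomb

end SahiC4Cube

end Summit.CriticalPhenomena.PercolationContinuityZ3.Theorems
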